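import Summits.CriticalPhenomena.SAWScalingLimit.Theorems.SAWDevelopingMapObservableToSLERestrictionIdentifiesTransfer
import Literature.Probability.RandomPlanarGeometry.SLEKappaRhoDrivingProofs
import Literature.Probability.RandomPlanarGeometry.RestrictionMeasuresFiveEighthsOneSided

/-!
# Crux `SAWDevelopingMap.ObservableToSLE` (stmt-CriticalPhenomena-10472), line
`floor-ratio-restriction-bootstrap`, registered stub `stub_restrictionIdentifies` (LSW closing)

Landing target:
`Summits/CriticalPhenomena/SAWScalingLimit/Theorems/SAWDevelopingMapObservableToSLERestrictionIdentifies.lean`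
(`--supports stmt-CriticalPhenomena-10472`).  The theorem statement at the end is the REGISTERED stub
signature verbatim (skeleton `Cruxes/ObservableToSLE/Lines/floor-ratio-restriction-bootstrap.lean`).

The registered stub `stub_restrictionIdentifies`: a probability subsequential limit law `μ` of the
critical hexagonal SAW curves in `(D; a, b)`, carried by the chordal carrier, all of whose lattice
hull-avoidance probabilities `P_δ(E_δ(D'))` over Jordan hull subdomains `D'` tend to `Φ'_A(0)^{5/8}`
(`A` the pulled-back hull of `D'`), is the chordal SLE(8/3) law of `D`.

**Proof.**  Fix a chordal uniformizing map `φ` and the SLE(8/3) law `ν` of `D` through `φ`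
(`exists_sleLaw_through`, sibling file `…RestrictionIdentifiesTransfer`).  TEST FAMILY: the images
`φ̂(A)` of the `+`-HULLS `A` of the half-plane that are fills of finite unions of dyadic squares.
PLUS-SIDE SEPARATION (`injOn_missCode_plusHulls`): their avoidance code is injective on the chordal
carrier — two distinct chordal simple curves pull back to distinct simple-path configurations
`K₁ ≠ K₂` of [LSW]'s `Ω`, a point of one of them lies strictly to the RIGHT of the other
(`exists_mem_rightDomain_of_ne`, from the tree's right/left domains of a configuration, the crossing
lemma `disjoint_rightDomain_leftDomain` and the frontier half of the Jordan curve theorem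
`IsSimplePath.mem_closure_rightDomain`), and "right of `K`" is witnessed by a dyadic `+`-hull
missing `K` (`RestrictionConfig.mem_rightDomain_iff_exists_dyadicUnion`).  By the transfer theorem
`CurveClass.Measure.ext_of_missCode_injOn` it then suffices to show
`μ{trace ∩ φ̂(T) = ∅} = ν{trace ∩ φ̂(T) = ∅}` for finite unions `T` of such `+`-hulls; both
vanish if the fill `B = hpFill T` swallows `0`, and otherwise both are the avoidance probabilities
of the `+`-hull `B` (`isPlusHull_hpFill_of_pos`), squeezed by the pull-backs of Jordan hull
subdomains with `B ∩ ℍ` interior to each (`stub_restrictionIdentifies_plusApprox`, the [LSW]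
Lemma 2.1 hulls), where `μ` and `ν` agree (`measure_avoid_eq_of_squeeze`: outer continuity of
avoidance and the portmanteau sandwich).
-/

noncomputable section

open scoped BigOperators Topology NNReal ENNReal Classical
open Filter Set MeasureTheory Metric
open Literature.Probability.LatticeModels (HexVertex hexGraph hexCenter)
open Literature.Probability.RandomPlanarGeometry
open Literature.Probability.RandomPlanarGeometry.SAW
open UpperHalfPlane (upperHalfPlaneSet isOpen_upperHalfPlaneSet)

namespace Summit.CriticalPhenomena.SAWScalingLimit.Theorems.ObservableToSLE.FloorRatio

/-! ### Plus-side separation: a chordal simple curve is determined by the `+`-hulls it avoids -/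

/-- **Two distinct simple-path configurations of `Ω`: a point of one lies strictly to the right of
the other.**  If `K₁ ≠ K₂` are simple paths from `0` to `∞` in `ℍ`, some point of `K₁` lies in the
right domain of `K₂` or some point of `K₂` lies in the right domain of `K₁`.  Otherwise each right
domain, a connected symmetric set containing `1` and missing the other mirror-doubled path, lies in
the other, so the two right domains `R` coincide; a point `z ∈ K₁ ∖ K₂` is then right or left of
`K₂` (`mem_rightDomain_or_mem_leftDomain`): not right (`R ∩ K₁ = ∅`), and not left, since `z` is a
limit of points of `R` (`IsSimplePath.mem_closure_rightDomain`, the frontier half of the Jordan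
curve theorem) while the left domain is an open set missing `R` (the crossing lemma
`disjoint_rightDomain_leftDomain`). [cite: Mccleary2006, Ch. 9, p. 129 (The Jordan Curve Theorem)] -/
theorem exists_mem_rightDomain_of_ne {K₁ K₂ : RestrictionConfig} (h₁ : K₁.IsSimplePath)
    (h₂ : K₂.IsSimplePath) (hne : K₁ ≠ K₂) :
    ∃ z : ℂ, (z ∈ (K₁ : Set ℂ) ∧ z ∈ K₂.rightDomain) ∨ (z ∈ (K₂ : Set ℂ) ∧ z ∈ K₁.rightDomain) := by
  by_contra H
  push Not at H
  -- each right domain lies in the other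
  have hsub : ∀ {K K' : RestrictionConfig}, (∀ z ∈ (K' : Set ℂ), z ∉ K.rightDomain) →
      K.rightDomain ⊆ K'.rightDomain := by
    intro K K' hKK'
    refine K.isConnected_rightDomain.isPreconnected.subset_connectedComponentIn
      K.one_mem_rightDomain fun w hw hwM => ?_
    have h0 : ∀ v ∈ K.rightDomain, v ∉ closure (K' : Set ℂ) := by
      intro v hv hvcl
      rw [K'.closure_eq] at hvcl
      rcases hvcl with hvK' | hv0
      · exact hKK' v hvK' hv
      · rw [mem_singleton_iff] at hv0
        exact K.rightDomain_subset_compl hv (hv0 ▸ K.zero_mem_mirrorClosure)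
    rcases hwM with hw1 | hw2
    · exact h0 w hw hw1
    · exact h0 _ (K.conj_mem_rightDomain_iff.2 hw) hw2
  have heq : K₁.rightDomain = K₂.rightDomain :=
    Subset.antisymm (hsub fun z hz hzR => (H z).2 hz hzR) (hsub fun z hz hzR => (H z).1 hz hzR)
  -- a point of one path off the other is neither right nor left of it
  have haux : ∀ {K K' : RestrictionConfig}, K.IsSimplePath → K.rightDomain = K'.rightDomain →
      ∀ z ∈ (K : Set ℂ), z ∉ (K' : Set ℂ) → False := by
    intro K K' hK hKK' z hz hz'
    have hzim : 0 < z.im := K.subset_upperHalfPlaneSet hz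
    rcases K'.mem_rightDomain_or_mem_leftDomain hzim hz' with hR | hL
    · rw [← hKK'] at hR
      exact K.rightDomain_subset_compl hR (K.closure_subset_mirrorClosure (subset_closure hz))
    · have hcl : z ∈ closure K'.rightDomain := hKK' ▸ hK.mem_closure_rightDomain hz
      rw [mem_closure_iff_nhds] at hcl
      obtain ⟨w, hwL, hwR⟩ := hcl _ (K'.isOpen_leftDomain.mem_nhds hL)
      exact Set.disjoint_left.1 K'.disjoint_rightDomain_leftDomain hwR hwL
  have hsets : (K₁ : Set ℂ) ≠ (K₂ : Set ℂ) := fun h => hne (Subtype.ext h)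
  by_cases h : (K₁ : Set ℂ) ⊆ (K₂ : Set ℂ)
  · have h' : ¬ (K₂ : Set ℂ) ⊆ (K₁ : Set ℂ) := fun h' => hsets (Subset.antisymm h h')
    obtain ⟨z, hz, hz'⟩ := Set.not_subset.1 h'
    exact haux h₂ heq.symm z hz hz'
  · obtain ⟨z, hz, hz'⟩ := Set.not_subset.1 h
    exact haux h₁ heq z hz hz'

section PlusCode

variable {D : DobrushinDomain} {φ : ConformalEquiv upperHalfPlaneSet D.carrier}

/-- **A chordal simple curve class is determined by its pulled-back trace.** [folklore] -/
theorem eq_of_pullbackTrace_eq {c₁ c₂ : CurveClass ℂ} (h₁ : c₁ ∈ chordalCarrier D)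
    (h₂ : c₂ ∈ chordalCarrier D) (h : φ.pullbackTrace c₁ = φ.pullbackTrace c₂) : c₁ = c₂ := by
  have hD : ∀ {c : CurveClass ℂ}, c ∈ chordalCarrier D →
      c.range = φ '' φ.pullbackTrace c ∪ {D.pt 0, D.pt 1} := by
    intro c hc
    have himg : φ '' φ.pullbackTrace c = c.range ∩ D.carrier := by
      rw [ConformalEquiv.pullbackTrace, image_image]
      refine (image_congr fun w hw => φ.apply_symm_apply hw.2).trans ?_
      rw [image_id']
    rw [himg]
    refine Subset.antisymm (fun w hw => ?_) (union_subset inter_subset_left ?_)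
    · rcases hc.2 hw with hwD | hab
      · exact Or.inl ⟨hw, hwD⟩
      · exact Or.inr hab
    · intro w hw
      rcases hw with hw | hw
      · have hs : c.source = D.pt 0 := hc.1.1.2
        rw [hw, ← hs]
        exact c.source_mem_range
      · rw [mem_singleton_iff] at hw
        have ht : c.target = D.pt 1 := hc.1.2
        rw [hw, ← ht]
        exact c.target_mem_range
  have hr : c₁.range = c₂.range := by rw [hD h₁, hD h₂, h]
  exact CurveClass.eq_of_mem_simple_of_range_eq h₁.1.1.1 h₂.1.1.1 hr (h₁.1.1.2.trans h₂.1.1.2.symm)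

/-- **PLUS-SIDE SEPARATION: the avoidance code of the images of the `+`-hulls is injective on the
chordal carrier.**  Let `C k` be a sequence of half-plane sets containing every `+`-hull which is the
half-plane fill of a finite union of dyadic squares.  Two distinct chordal simple curve classes have
distinct pulled-back configurations `K₁ ≠ K₂` (simple paths from `0` to `∞`,
`isSimplePath_pullbackConfig`), so some point `z` of one, say of `K₁`, is strictly right of the other
(`exists_mem_rightDomain_of_ne`); "right of `K₂`" is witnessed by a dyadic `+`-hull `A ∋ z` missing
`K₂` (`RestrictionConfig.mem_rightDomain_iff_exists_dyadicUnion`), whose image `φ̂(A)` meets the trace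
of the first class and misses that of the second (boundary correspondence): the codes differ.
[cite: LawlerSchrammWerner2003Restriction, §8.1 p. 31 (right filling) with Lemma 3.2 (p. 10)] -/
theorem injOn_missCode_plusHulls (hφ : D.IsChordalUniformizing φ) {C : ℕ → Set ℂ}
    (hrich : ∀ (n : ℕ) (F : Finset (ℤ × ℤ)), IsPlusHull (hpFill (dyadicUnion n F)) →
      ∃ k, C k = hpFill (dyadicUnion n F)) :
    InjOn (CurveClass.missCode fun k => φ.boundaryExtension '' C k) (chordalCarrier D) := by
  classical
  have hC : JordanDomain.exists_continuousOn_extension := JordanDomain.exists_continuousOn_extension_holds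
  have hJarc : Literature.Topology.PlaneTopology.JordanArcSeparation :=
    Literature.Topology.PlaneTopology.JordanArcSeparation_holds
  -- separation of codes from a point of one configuration right of the other
  have hsep : ∀ {c c' : CurveClass ℂ}, c ∈ chordalCarrier D → c' ∈ chordalCarrier D → ∀ z : ℂ,
      z ∈ ((pullbackConfig hJarc hC hφ c : RestrictionConfig) : Set ℂ) →
      z ∈ (pullbackConfig hJarc hC hφ c').rightDomain →
      CurveClass.missCode (fun k => φ.boundaryExtension '' C k) c ≠
        CurveClass.missCode (fun k => φ.boundaryExtension '' C k) c' := by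
    intro c c' hc hc' z hz hzR hcode
    have hzim : 0 < z.im := (pullbackConfig hJarc hC hφ c).subset_upperHalfPlaneSet hz
    obtain ⟨n, F, hzS, hplus, hdisj⟩ :=
      ((pullbackConfig hJarc hC hφ c').mem_rightDomain_iff_exists_dyadicUnion hzim).1 hzR
    obtain ⟨k, hk⟩ := hrich n F hplus
    set A : Set ℂ := hpFill (dyadicUnion n F) with hA
    have hzA : z ∈ A := inter_subset_hpFill _ ⟨hzS, hzim⟩
    -- `c'` avoids `φ̂(A)`
    have h2 : CurveClass.missCode (fun k => φ.boundaryExtension '' C k) c' k = true := by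
      rw [CurveClass.missCode_eq_true_iff]
      change Disjoint c'.range (φ.boundaryExtension '' C k)
      rw [hk, CurveClass.disjoint_range_iff]
      refine (disjoint_pullbackTrace_iff_mem_rangeSubset hC hφ hc' hplus.1.1.subset_closure
        hplus.1.2).1 ?_
      rw [← coe_pullbackConfig (hJarc := hJarc) (hC := hC) (hφ := hφ) hc']
      exact hdisj.mono_left subset_closure
    -- `c` meets `φ̂(A)` at `φ z`
    have h1 : CurveClass.missCode (fun k => φ.boundaryExtension '' C k) c k = false := by
      rw [Bool.eq_false_iff, Ne, CurveClass.missCode_eq_true_iff]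
      change ¬ Disjoint c.range (φ.boundaryExtension '' C k)
      rw [hk, Set.not_disjoint_iff]
      have hz' : z ∈ φ.pullbackTrace c := by
        rw [← coe_pullbackConfig (hJarc := hJarc) (hC := hC) (hφ := hφ) hc]; exact hz
      obtain ⟨w, ⟨hw, hwD⟩, rfl⟩ := hz'
      refine ⟨w, hw, φ.symm w, hzA, ?_⟩
      rw [φ.boundaryExtension_eq (φ.symm_mapsTo hwD), φ.apply_symm_apply hwD]
    have := congrFun hcode k
    rw [h1, h2] at this
    exact Bool.false_ne_true this
  intro c₁ h₁ c₂ h₂ hcode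
  by_contra hne
  have hK : pullbackConfig hJarc hC hφ c₁ ≠ pullbackConfig hJarc hC hφ c₂ := by
    intro hK
    have := congrArg (fun K : RestrictionConfig => (K : Set ℂ)) hK
    simp only [coe_pullbackConfig (hJarc := hJarc) (hC := hC) (hφ := hφ) h₁,
      coe_pullbackConfig (hJarc := hJarc) (hC := hC) (hφ := hφ) h₂] at this
    exact hne (eq_of_pullbackTrace_eq h₁ h₂ this)
  obtain ⟨z, hz⟩ := exists_mem_rightDomain_of_ne (isSimplePath_pullbackConfig c₁)
    (isSimplePath_pullbackConfig c₂) hK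
  rcases hz with ⟨hz₁, hzR⟩ | ⟨hz₂, hzR⟩
  · exact hsep h₁ h₂ z hz₁ hzR hcode
  · exact hsep h₂ h₁ z hz₂ hzR hcode.symm

end PlusCode

/-! ### Finite unions of `+`-hulls -/

/-- **Finite unions of `+`-hulls are `+`-anchored or empty**, compact, in `ℍ̄`, off `0` (a bounded
hull has no floating pieces, `IsBoundedHull.isConnected_union_im_nonpos`). [folklore] -/
theorem biUnion_plusHull {C : ℕ → Set ℂ} (hC : ∀ n, C n = ∅ ∨ IsPlusHull (C n)) (s : Finset ℕ) :
    ((⋃ n ∈ s, C n) = ∅ ∨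
      (IsAnchored (⋃ n ∈ s, C n) ∧ ∀ x : ℝ, (x : ℂ) ∈ (⋃ n ∈ s, C n) → 0 < x)) ∧
      IsCompact (⋃ n ∈ s, C n) ∧ (⋃ n ∈ s, C n) ⊆ closure upperHalfPlaneSet ∧
      (0 : ℂ) ∉ ⋃ n ∈ s, C n := by
  classical
  have hcase : ∀ n, C n = ∅ ∨ (IsAnchored (C n) ∧ ∀ x : ℝ, (x : ℂ) ∈ C n → 0 < x) := fun n => by
    rcases hC n with h | h
    · exact Or.inl h
    · exact Or.inr ⟨⟨h.1.2, h.1.1.isConnected_union_im_nonpos⟩, h.2⟩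
  have hcpt : ∀ n, IsCompact (C n) := fun n => by
    rcases hC n with h | h
    · rw [h]; exact isCompact_empty
    · exact h.1.1.isCompact
  have hcl : ∀ n, C n ⊆ closure upperHalfPlaneSet := fun n => by
    rcases hC n with h | h
    · rw [h]; exact empty_subset _
    · exact h.1.1.subset_closure
  refine ⟨?_, s.finite_toSet.isCompact_biUnion fun n _ => hcpt n,
    iUnion₂_subset fun n _ => hcl n, ?_⟩
  · induction s using Finset.induction_on with
    | empty => left; simp
    | insert a s ha ih =>
      rw [Finset.set_biUnion_insert]
      rcases hcase a with h0 | hA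
      · rw [h0, empty_union]; exact ih
      · rcases ih with h0' | hA'
        · rw [h0', union_empty]; exact Or.inr hA
        · refine Or.inr ⟨hA.1.union hA'.1, fun x hx => ?_⟩
          rcases hx with hx | hx
          · exact hA.2 x hx
          · exact hA'.2 x hx
  · simp only [mem_iUnion, exists_prop, not_exists, not_and]
    intro n _ h0
    rcases hcase n with h | h
    · rw [h] at h0; exact h0
    · exact h.1.1 h0

/-- The avoidance event of the empty image is everything. [folklore] -/
theorem rangeSubset_compl_image_empty {f : ℂ → ℂ} :
    (CurveClass.rangeSubset (f '' (∅ : Set ℂ))ᶜ : Set (CurveClass ℂ)) = univ := by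
  ext c
  simp [CurveClass.mem_rangeSubset]

/-! ### The registered stub -/

/-- **Registered stub `stub_restrictionIdentifies`** (crux item stmt-CriticalPhenomena-10472, line
`floor-ratio-restriction-bootstrap`; statement verbatim from the skeleton): THE LSW CLOSING.  A
probability subsequential limit law `μ` of the critical hexagonal SAW curves in a Dobrushin domain
`(D; a, b)`, carried by the chordal carrier, all of whose lattice hull-avoidance probabilities
`P_δ(E_δ(D'))` over the Jordan hull subdomains `D'` of `D` tend to `Φ'_A(0)^{5/8}` (`A` the pulled-back
hull of `D'` under a chordal uniformizing map), is the chordal SLE(8/3) law of `D`.  Proof (module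
docstring): transfer theorem `CurveClass.Measure.ext_of_missCode_injOn` against the SLE(8/3) law `ν`
through a uniformizing map `φ` (`exists_sleLaw_through`, [LSW] Thm. 6.1), with the countable test
family of images of the `+`-hulls which are fills of finite unions of dyadic squares — their
avoidance code is injective on the chordal carrier (`injOn_missCode_plusHulls`: right/left domains of
a configuration, the crossing lemma and the frontier half of the Jordan curve theorem, all in the
tree) — finite unions of which have fills that swallow `0` or are `+`-hulls
(`isPlusHull_hpFill_of_pos`) squeezed by the [LSW] Lemma 2.1 hulls of Jordan hull subdomains
(`stub_restrictionIdentifies_plusApprox`), where the avoidance probabilities of `μ` and `ν` agree by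
outer continuity of avoidance and the portmanteau sandwich (`measure_avoid_eq_of_squeeze`).
[cite: LawlerSchrammWerner2003Restriction, Lemma 3.2 (p. 10), Lemma 2.1 (p. 8), Thm. 6.1 (p. 23), §8.1 (p. 31), transposed] -/
theorem stub_restrictionIdentifies :
  ∀ (D : DobrushinDomain) (a b : ℝ → HexVertex) (μ : Measure (CurveClass ℂ)),
  IsEmbEndpointApprox hexGraph hexCenter D a b → IsProbabilityMeasure μ →
  IsSubseqLimitLaw (fun δ (γ : HexDomainSAW D.carrier δ (a δ) (b δ)) => γ.curve)
  (fun δ => hexSAWLaw D.carrier δ (a δ) (b δ)) μ →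
  (∀ᵐ c ∂μ, c ∈ chordalCarrier D) →
  (∀ (D' : DobrushinDomain) (φ : ConformalEquiv upperHalfPlaneSet D.carrier)
  (Φ : ConformalEquiv (upperHalfPlaneSet \ φ.pullbackHull D') upperHalfPlaneSet) (d : ℝ),
  D.IsHullSubdomain D' → D.IsChordalUniformizing φ →
  IsRestrictionMap (φ.pullbackHull D') Φ → HasRestrictionDeriv (φ.pullbackHull D') Φ d →
  Tendsto (fun δ : ℝ => ((hexSAWLaw D.carrier δ (a δ) (b δ))
  {γ | (∀ v ∈ γ.walk.support, v ∈ embMeshVertices hexCenter D'.carrier δ) ∧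
  ∀ e ∈ γ.walk.darts,
  (embMeshGraph hexGraph hexCenter D'.carrier δ).Adj e.fst e.snd}).toReal)
  (𝓝[>] 0) (𝓝 (d ^ ((5 : ℝ) / 8)))) →
  IsSLELaw ((8 : ℝ≥0) / 3) D μ := by
  intro D a b μ hab hμp hμ hcar hlat
  classical
  haveI := hμp
  have hC : JordanDomain.exists_continuousOn_extension := JordanDomain.exists_continuousOn_extension_holds
  have hJarc : Literature.Topology.PlaneTopology.JordanArcSeparation :=
    Literature.Topology.PlaneTopology.JordanArcSeparation_holds
  have hFa : isSimplyConnected_of_isConnected_compl := isSimplyConnected_of_isConnected_compl_holds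
  obtain ⟨φ, hφ⟩ := MarkedDomain.exists_isChordalUniformizing_holds D
  obtain ⟨ν, hνsle, hνp, hνcar, hνav⟩ := exists_sleLaw_through hφ
  haveI := hνp
  suffices hμν : μ = ν by
    obtain ⟨Γ, hΓ, hν⟩ := hνsle
    exact ⟨Γ, hΓ, hμν.trans hν⟩
  -- the countable family of dyadic `+`-hulls
  set A : ℕ × Finset (ℤ × ℤ) → Set ℂ := fun p =>
    if IsPlusHull (hpFill (dyadicUnion p.1 p.2)) then hpFill (dyadicUnion p.1 p.2) else ∅ with hAdef
  set C : ℕ → Set ℂ := fun k => (Encodable.decode (α := ℕ × Finset (ℤ × ℤ)) k).elim ∅ A with hCdef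
  have hAspec : ∀ p, A p = ∅ ∨ IsPlusHull (A p) := fun p => by
    by_cases h : IsPlusHull (hpFill (dyadicUnion p.1 p.2))
    · right; rw [hAdef]; simp only [if_pos h]; exact h
    · left; rw [hAdef]; simp only [if_neg h]
  have hCspec : ∀ k, C k = ∅ ∨ IsPlusHull (C k) := fun k => by
    change (Encodable.decode (α := ℕ × Finset (ℤ × ℤ)) k).elim ∅ A = ∅ ∨
      IsPlusHull ((Encodable.decode (α := ℕ × Finset (ℤ × ℤ)) k).elim ∅ A)
    cases Encodable.decode (α := ℕ × Finset (ℤ × ℤ)) k with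
    | none => exact Or.inl rfl
    | some p => exact hAspec p
  have hrich : ∀ (n : ℕ) (F : Finset (ℤ × ℤ)), IsPlusHull (hpFill (dyadicUnion n F)) →
      ∃ k, C k = hpFill (dyadicUnion n F) := fun n F h => by
    refine ⟨Encodable.encode (n, F), ?_⟩
    change (Encodable.decode (α := ℕ × Finset (ℤ × ℤ)) (Encodable.encode (n, F))).elim ∅ A = _
    rw [Encodable.encodek]
    change A (n, F) = _
    rw [hAdef]
    exact if_pos h
  have hCclosed : ∀ k, IsClosed (φ.boundaryExtension '' C k) := fun k => by
    rcases hCspec k with h | h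
    · rw [h, image_empty]; exact isClosed_empty
    · exact (MarkedDomain.isCompact_image_boundaryExtension hC h.1.1.subset_closure
        h.1.1.isCompact).isClosed
  refine CurveClass.Measure.ext_of_missCode_injOn hCclosed measurableSet_chordalCarrier
    (injOn_missCode_plusHulls hφ hrich) hcar hνcar fun s => ?_
  obtain ⟨hanch, hcpt, hcl, h0⟩ := biUnion_plusHull hCspec s
  have himage : (⋃ n ∈ s, φ.boundaryExtension '' C n) = φ.boundaryExtension '' ⋃ n ∈ s, C n := by
    simp only [image_iUnion]
  rw [himage]
  set T : Set ℂ := ⋃ n ∈ s, C n with hT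
  have hTc : IsClosed T := hcpt.isClosed
  have hTb : Bornology.IsBounded T := hcpt.isBounded
  rcases hanch with hempty | ⟨hanchT, hposT⟩
  · rw [hempty, rangeSubset_compl_image_empty, measure_univ, measure_univ]
  by_cases hfill : (0 : ℂ) ∈ hpFill T
  · have h1 := measure_rangeSubset_compl_image_eq_zero hC hφ (fun _ => μ) hcar hTc hcl h0 hfill
    have h2 := measure_rangeSubset_compl_image_eq_zero hC hφ (fun _ => ν) hνcar hTc hcl h0 hfill
    exact h1.trans h2.symm
  have hstar : IsStarHull (hpFill T) := isStarHull_hpFill hFa hTc hTb hanchT.2 hfill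
  have h1 := measure_rangeSubset_compl_image_eq hJarc hC hφ (fun _ => μ) hcar hTc hTb hcl h0 hstar
  have h1' := ChordalFamily.pullbackLaw_avoid (hJarc := hJarc) (hC := hC) (hφ := hφ) (fun _ => μ)
    hcar hstar
  have h2 := measure_rangeSubset_compl_image_eq hJarc hC hφ (fun _ => ν) hνcar hTc hTb hcl h0 hstar
  have h2' := ChordalFamily.pullbackLaw_avoid (hJarc := hJarc) (hC := hC) (hφ := hφ) (fun _ => ν)
    hνcar hstar
  refine h1.trans (h1'.trans (Eq.trans ?_ (h2.trans h2').symm))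
  rcases (hpFill T).eq_empty_or_nonempty with hem | hne
  · rw [hem, rangeSubset_compl_image_empty, measure_univ, measure_univ]
  have hplus : IsPlusHull (hpFill T) := isPlusHull_hpFill_of_pos hTc hposT hstar
  obtain ⟨Dk, hDk, hanti, hint, hlim⟩ :=
    stub_restrictionIdentifies_plusApprox D φ (hpFill T) hφ hplus hne
  exact measure_avoid_eq_of_squeeze hab hμ hcar hlat hφ hνcar hνav hstar hDk hanti hint hlim

end Summit.CriticalPhenomena.SAWScalingLimit.Theorems.ObservableToSLE.FloorRatio

end
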